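import Literature.NumberTheory.LFunctions.Zhang2022.Section8Lemma84
import Literature.NumberTheory.LFunctions.Zhang2022.RepairGapLemma84Premise
import Literature.NumberTheory.LFunctions.Zhang2022.RepairGapLemma57Premise
import Literature.NumberTheory.LFunctions.Zhang2022.RepairGapExceptionalZeroPremise
import Literature.NumberTheory.LFunctions.Zhang2022.RepairGapPartIIIDoors
import HarnessLib

/-!
# Zhang (2022), rescue GAP/BED (D-0124 (3)(4)): the edge «Lemma 8.3 (relative) ⇒ Lemma 8.4 (relative)» — the leaf
# `Skeleton.Lemma84Rel c′` of `theorem1_of_leaves` — with BOTH guards `AssumptionA` replaced by `‖L(1,χ)‖ ≤ 𝓛⁻¹⁵`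

Topic `Literature/NumberTheory/LFunctions/Zhang2022` (Landau–Siegel audit tree; verdict-neutral).
Y. Zhang, *Discrete mean estimates and the Landau–Siegel zero*, arXiv:2211.02515v1 (2022)
[Zhang2022LandauSiegel] — **an unrefereed manuscript under adjudication; nothing in this file asserts or
denies its Theorems 1–2, and nothing here is a claim about Landau–Siegel zeros. The programme SEARCHES and
TYPES; no claim about Landau–Siegel zeros, Theorems 1–2 of arXiv:2211.02515 or a repaired Margin232 until a
kernel theorem says so.**

Lemma 8.4 in its relative form of record (`Skeleton.Lemma84Rel c′`, GAP row G-adj1-1; the binder `h84` of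
`theorem1_of_leaves`) is a tree theorem via the edge `Lemma84.lemma84Rel_of_lemma83Rel : Lemma83Rel c′ → Lemma84Rel c′`
(Zhang's proof of Lemma 8.4, §8 p. 47, carried out in the kernel; `set_option maxHeartbeats 800000`). That edge consumes
Assumption (A) through FOUR doors: the exceptional-zero package (`Lemma84.exceptional_package`: `1 − ρ̃ ≤ K𝓛⁻²⁰²²` and
`1/L` next to `ρ̃`), Lemma 5.7 (`Lemma57.lemma_5_7`), Lemma 5.8 inside the core `Lemma84.lemma84_core`, and the guard of
its input node `Lemma83Rel`. All four have minimum-premise forms in the tree now: `Repair.Gap.exceptional_package_pow15`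
(`RepairGapExceptionalZeroPremise` — the door's own premise is Hecke–Landau's `‖L(1,χ)‖ < A/(log 4D)²`),
`Repair.Gap.lemma57_of_norm_le` (p562983; `‖L(1,χ)‖ ≤ c/𝓛`), `Repair.Gap.lemma84_core_of_norm_le_pow15` (p572334), and —
for the input — the SAME weakening of the guard. This file re-runs the edge VERBATIM with those substitutions:

* `lemma84Rel_pow15_of_lemma83Rel_pow15` — from the body of `Skeleton.Lemma83Rel c′` with guard `‖L(1,χ)‖ ≤ 𝓛⁻¹⁵` to the
  body of `Skeleton.Lemma84Rel c′` with guard `‖L(1,χ)‖ ≤ 𝓛⁻¹⁵`, SAME constant `C_fin` and thresholds (plus `𝓛 ≥ 1/c₅₇`,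
  `𝓛 ≥ 1` for the Lemma 5.7 door); `1 − ρ̃ ≤ K𝓛⁻¹⁵` is all the proof uses of `ρ̃`'s size (`≤ K/𝓛²`, `≤ K/𝓛¹⁰`);
* `lemma84Rel_of_assumptionAWith_of_lemma83Rel_pow15` — hence under `Repair.Bed.AssumptionAWith E`, every real `E ≥ 15`.

HONESTY NOTE: this is an EDGE twin. Its hypothesis — Lemma 8.3 (relative) under the `𝓛⁻¹⁵` guard — is NOT discharged here:
the tree discharges `Lemma83Rel` through Appendix A (`Skeleton.lemma83Rel_holds`, nodes `StepA_u007_*` typed under the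
printed guard); re-keying Appendix A is not attempted (planner-sized). With it, all three Part-II leaves of node group 2
that consume (A) — Lemma 8.2 (`Skeleton.lemma82_pow15`), Lemma 10.1 (`Lemma101.lemma101_pow15`), Lemma 8.4 (this edge) —
are kernel at (A)-exponent 15 modulo the 8.3 input. Theorems only; no definition, no named fact; nothing about (A) itself.

## References

* Y. Zhang, arXiv:2211.02515v1 (2022), §8 Lemmas 8.3–8.4 (pp. 17, 46–47); §5 Lemmas 5.5, 5.7, 5.8.
  [cite: Zhang2022LandauSiegel, §8 Lemma 8.4] [cite: MontgomeryVaughan2007, §6.2, Thm 11.4]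
-/

noncomputable section

open Complex Real Finset

namespace Literature.NumberTheory.LFunctions.Zhang2022.Lemma84

open Skeleton
open Literature.NumberTheory.LFunctions.Zhang2022.Repair.Bed (AssumptionAWith)

/-- A threshold `D₁` beyond which `log D ≥ M` (tree-private, repeated). [folklore] -/
private theorem exists_nat_le_log'' (M : ℝ) : ∃ D₀ : ℕ, ∀ D : ℕ, D₀ ≤ D → M ≤ Real.log D := by
  refine ⟨⌈Real.exp M⌉₊ + 1, fun D hD => ?_⟩
  have h1 : Real.exp M ≤ D := by
    have : (⌈Real.exp M⌉₊ : ℝ) + 1 ≤ D := by exact_mod_cast hD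
    linarith [Nat.le_ceil (Real.exp M)]
  have hD0 : (0 : ℝ) < D := lt_of_lt_of_le (Real.exp_pos M) h1
  rw [Real.le_log_iff_exp_le hD0]
  exact h1

set_option maxHeartbeats 800000 in
/-- **Lemma 8.4 (relative) from Lemma 8.3 (relative), both under the minimum premise `‖L(1,χ)‖ ≤ 𝓛⁻¹⁵`** (twin of
`Lemma84.lemma84Rel_of_lemma83Rel`, same error `C_fin·𝓛⁻⁶·(∏_{q∣dr}(1−q⁻¹)⁻¹)²`): Zhang's proof of Lemma 8.4 verbatim, with
the exceptional-zero package, Lemma 5.7 and the Lemma 8.4 core taken through their `𝓛⁻¹⁵` doors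
(`Repair.Gap.exceptional_package_pow15`, `Repair.Gap.lemma57_of_norm_le`, `Repair.Gap.lemma84_core_of_norm_le_pow15`).
[cite: Zhang2022LandauSiegel, §8 Lemma 8.4] [cite: MontgomeryVaughan2007, §6.2, Thm 11.4] -/
theorem lemma84Rel_pow15_of_lemma83Rel_pow15 {c' : ℝ}
    (h83 : (∃ C : ℝ, ForAllLarge fun D _ χ => ‖χ.LFunction 1‖ ≤ 1 / Real.log D ^ 15 →
      ∀ j ∈ ({1, 2, 3} : Finset ℕ), ∀ d r : ℕ, 1 ≤ d → 1 ≤ r → ((d * r : ℕ) : ℝ) < bigP D / bigT D ^ 2 →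
        ∃ U : ℂ → ℂ, DifferentiableOn ℂ U {s : ℂ | 9 / 10 < s.re} ∧
          (∀ s : ℂ, 1 < s.re → U s = χ.LFunction s /
              (χ.LFunction (s + betaJ c' D (j + 1)) * χ.LFunction (s + betaJ c' D (j + 2))) *
                xiSeries c' χ j d r s) ∧
          (∀ s : ℂ, 9 / 10 < s.re →
            ‖U s‖ ≤ C * ∏ q ∈ (d * r).primeFactors, (1 + C * (q : ℝ) ^ (-s.re))) ∧
          (∀ s : ℂ, ‖s - 1‖ ≤ 5 * alpha D →
            ‖U s - PiW χ d r‖ ≤ C * (ell D ^ 8)⁻¹ * ∏ q ∈ (d * r).primeFactors, (1 - (q : ℝ)⁻¹)⁻¹))) :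
    ∃ C : ℝ, ForAllLarge fun D _ χ => ‖χ.LFunction 1‖ ≤ 1 / Real.log D ^ 15 →
      ∀ j ∈ ({1, 2, 3} : Finset ℕ), ∀ μ ∈ ({6, 7} : Finset ℕ), ∀ d r : ℕ, 1 ≤ d → 1 ≤ r →
        ((d * r : ℕ) : ℝ) < bigP D / bigT D ^ 2 → ∀ y : ℝ, bigT D < y → y < bigP D →
          ‖(∑ n ∈ Finset.Ico 1 ⌈y⌉₊, χ (n : ZMod D) * xiZero c' D j n d r / (n : ℂ) *
                ((y / n : ℝ) : ℂ) ^ (-betaMu D μ) * (Real.log (y / n) : ℂ)) -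
              deriv χ.LFunction 1 * PiW χ d r * frakgW c' D j μ y‖ ≤
            C * (ell D ^ 6)⁻¹ * (∏ q ∈ (d * r).primeFactors, (1 - (q : ℝ)⁻¹)⁻¹) ^ 2 := by
  obtain ⟨C₈₃, D83, h83⟩ := h83
  obtain ⟨c, hc, hc4, Cinv, hCinv, K, hK, D₁, hpack⟩ := Repair.Gap.exceptional_package_pow15
  obtain ⟨L₅₇, c57, hc57, h57⟩ := Repair.Gap.lemma57_of_norm_le
  -- constants
  set C : ℝ := |C₈₃| with hCdef
  have hC0 : 0 ≤ C := abs_nonneg _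
  set K₈ : ℝ := 7 + 15 * |c'| with hK₈
  have hK₈1 : 1 ≤ K₈ := by rw [hK₈]; linarith [abs_nonneg c']
  set C₅ : ℝ := 1 + 16 * Real.exp (9 / 2) * π ^ 2 * K₈ ^ 2 with hC₅
  set ℓ₀ : ℝ := Real.exp (-1) / 4 with hℓ₀
  have hℓ₀0 : 0 < ℓ₀ := by positivity
  set m : ℕ := ⌈2 * C⌉₊ with hm
  set A₁ : ℝ := C * (Real.exp (8 * C + 4 * C * ((Nat.factorial 9 : ℝ) / 2 ^ 9)) * 2 ^ m) with hA₁
  have hA₁0 : 0 ≤ A₁ := by positivity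
  set Cfin : ℝ := 1 / (2 * π) * (2 * Real.exp π * A₁ * (m + 33).factorial +
      40800 * π * A₁ * Cinv / c ^ 2 * ((10 * (m + 11)).factorial / (c / 8) ^ (10 * (m + 11))) +
      1800 * Real.exp π * A₁ * Cinv * ((m + 9).factorial / 2 ^ (m + 9)) +
      56 * Real.exp π * (C₅ * (24 * K₈ ^ 2 + 2 * K₈) / π + 128 * K₈ ^ 3 * C * Real.exp (9 / 2)))
    with hCfin
  -- the threshold
  set Lmax : ℝ := max (max (max 3 L₅₇) (max (8 * π / c) (16 * K / c)))
    (max (max (K + 1) (K₈ * π)) (4 * C₅ / (ℓ₀ * π))) with hLmax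
  obtain ⟨D₂, hD₂⟩ := exists_nat_le_log'' (max Lmax (max 1 (1 / c57)))
  refine ⟨Cfin, max (max D83 D₁) D₂, fun D _ χ hD hq hp h15 j hj μ _ d r hd hr hdr y hy1 hy2 => ?_⟩
  have hD83 : D83 ≤ D := le_trans (le_trans (le_max_left _ _) (le_max_left _ _)) hD
  have hD₁ : D₁ ≤ D := le_trans (le_trans (le_max_right _ _) (le_max_left _ _)) hD
  have hLm0 := hD₂ D (le_trans (le_max_right _ _) hD)
  have hLm : Lmax ≤ Real.log D := le_trans (le_max_left _ _) hLm0
  have hLc57 : 1 / c57 ≤ Real.log D := le_trans (le_trans (le_max_right _ _) (le_max_right _ _)) hLm0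
  set 𝓛 : ℝ := Real.log D with h𝓛def
  have h𝓛3 : 3 ≤ 𝓛 := le_trans (by simp [hLmax]) hLm
  have hL57 : L₅₇ ≤ 𝓛 := le_trans (by simp [hLmax]) hLm
  have hL8πc : 8 * π / c ≤ 𝓛 := le_trans (by simp [hLmax]) hLm
  have hL16K : 16 * K / c ≤ 𝓛 := le_trans (by simp [hLmax]) hLm
  have hLK1 : K + 1 ≤ 𝓛 := le_trans (by simp [hLmax]) hLm
  have hLK₈ : K₈ * π ≤ 𝓛 := le_trans (by simp [hLmax]) hLm
  have hLC₅ : 4 * C₅ / (ℓ₀ * π) ≤ 𝓛 := le_trans (by simp [hLmax]) hLm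
  have h𝓛0 : 0 < 𝓛 := by linarith
  have h𝓛1 : 1 ≤ 𝓛 := by linarith
  -- the Lemma 5.7 door: `𝓛⁻¹⁵ ≤ c₅₇/𝓛` since `𝓛¹⁴ ≥ 𝓛 ≥ 1/c₅₇`
  have hc57L : ‖χ.LFunction 1‖ ≤ c57 / Real.log D := by
    refine h15.trans ?_
    rw [← h𝓛def, div_le_div_iff₀ (pow_pos h𝓛0 _) h𝓛0]
    have h14 : 𝓛 ≤ 𝓛 ^ 14 := le_self_pow₀ h𝓛1 (by norm_num)
    have h1c : 1 ≤ c57 * 𝓛 ^ 14 := by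
      have h := mul_le_mul_of_nonneg_left (hLc57.trans h14) hc57.le
      rwa [mul_one_div_cancel hc57.ne'] at h
    calc 1 * 𝓛 = 𝓛 := one_mul _
      _ ≤ (c57 * 𝓛 ^ 14) * 𝓛 := le_mul_of_one_le_left h𝓛0.le h1c
      _ = c57 * 𝓛 ^ 15 := by ring
  have hℓ : ell D = 𝓛 := rfl
  have hπ0 := Real.pi_pos
  have hπ3 := Real.pi_gt_three
  -- `D` itself
  have hD0 : (0 : ℝ) < D := by
    rcases lt_or_ge 0 (D : ℝ) with h | h
    · exact h
    · have : Real.log (D : ℝ) ≤ 0 := by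
        have : (D : ℝ) = 0 := le_antisymm h (Nat.cast_nonneg D)
        rw [this, Real.log_zero]
      linarith
  have hDexp : (D : ℝ) = Real.exp 𝓛 := by rw [h𝓛def, Real.exp_log hD0]
  have hD3 : (3 : ℝ) ≤ D := by
    have : Real.exp 3 ≤ Real.exp 𝓛 := Real.exp_le_exp.2 h𝓛3
    have h3 : (3 : ℝ) ≤ Real.exp 3 := by have := Real.add_one_le_exp (3 : ℝ); linarith
    linarith
  have hD2 : 2 ≤ D := by exact_mod_cast (show (2 : ℝ) ≤ D by linarith)
  have hχ1 : χ ≠ 1 := Lemma31.ne_one_of_isPrimitive χ hD2 hp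
  -- parameters
  set α : ℝ := alpha D with hαdef
  have hαeq : α = π / 𝓛 ^ 9 := alpha_eq D
  have hα0 : 0 < α := by rw [hαeq]; positivity
  set η : ℝ := c / (8 * 𝓛) with hηdef
  have hη0 : 0 < η := by positivity
  have hη' : η ≤ 1 / 96 := by
    calc η = c / (8 * 𝓛) := hηdef
      _ ≤ (1 / 4) / (8 * 3) := by gcongr
      _ = 1 / 96 := by norm_num
  have hαη : α ≤ η := by
    -- `π/𝓛⁹ ≤ c/(8𝓛)` since `8π/c ≤ 𝓛 ≤ 𝓛⁸`
    rw [hαeq, hηdef, div_le_div_iff₀ (by positivity) (by positivity)]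
    have h8 : 𝓛 ≤ 𝓛 ^ 8 := le_self_pow₀ h𝓛1 (by norm_num)
    have h1 : 8 * π ≤ c * 𝓛 := by rw [div_le_iff₀ hc] at hL8πc; linarith
    calc π * (8 * 𝓛) = (8 * π) * 𝓛 := by ring
      _ ≤ (c * 𝓛) * 𝓛 ^ 8 := by gcongr
      _ = c * 𝓛 ^ 9 := by ring
  have hη40 : η ≤ 1 / 40 := by linarith
  -- the exceptional zero and the zero-free package
  obtain ⟨ρ, hρ1, hρK, hLρ, hL'ρ, hzfp⟩ := hpack D χ hD₁ hχ1 h15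
  have hKρ : 1 - ρ ≤ K / 𝓛 ^ 2 := by
    refine hρK.trans ?_
    rw [← div_eq_mul_inv]
    exact div_le_div_of_nonneg_left hK.le (by positivity) (pow_le_pow_right₀ h𝓛1 (by norm_num))
  have hρη : 1 - η / 2 ≤ ρ := by
    -- `K/𝓛² ≤ c/(16𝓛)` since `16K/c ≤ 𝓛`
    have h1 : K / 𝓛 ^ 2 ≤ c / (16 * 𝓛) := by
      rw [div_le_div_iff₀ (by positivity) (by positivity)]
      have h16 : 16 * K ≤ c * 𝓛 := by rw [div_le_iff₀ hc] at hL16K; linarith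
      calc K * (16 * 𝓛) = (16 * K) * 𝓛 := by ring
        _ ≤ (c * 𝓛) * 𝓛 := by gcongr
        _ = c * 𝓛 ^ 2 := by ring
    rw [hηdef]
    have : c / (8 * 𝓛) / 2 = c / (16 * 𝓛) := by ring
    linarith
  have hρα : 1 - α / 2 < ρ := by
    -- `K/𝓛² < π/(2𝓛⁹)`? no: use `1 − ρ ≤ K𝓛⁻²⁰²² ≤ K/𝓛¹⁰ < π/(2𝓛⁹)` since `K + 1 ≤ 𝓛`
    have h1 : 1 - ρ ≤ K / 𝓛 ^ 10 := by
      refine hρK.trans ?_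
      rw [← div_eq_mul_inv]
      exact div_le_div_of_nonneg_left hK.le (by positivity) (pow_le_pow_right₀ h𝓛1 (by norm_num))
    have h2 : K / 𝓛 ^ 10 < π / 𝓛 ^ 9 / 2 := by
      rw [div_div, div_lt_div_iff₀ (by positivity) (by positivity)]
      have h3 : K * 2 < π * 𝓛 := by
        calc K * 2 < 3 * (K + 1) := by linarith
          _ ≤ π * 𝓛 := mul_le_mul hπ3.le hLK1 (by linarith) (by linarith)
      calc K * (𝓛 ^ 9 * 2) = (K * 2) * 𝓛 ^ 9 := by ring
        _ < (π * 𝓛) * 𝓛 ^ 9 := by gcongr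
        _ = π * 𝓛 ^ 10 := by ring
    rw [hαeq]; linarith
  -- the `1/L` package on `Re s ≥ 1 − 2η`, `|Im s| ≤ D + 1`
  have hlog5 : Real.log ((D : ℝ) + 5) ≤ 2 * 𝓛 := by
    have h1 : (D : ℝ) + 5 ≤ (D : ℝ) ^ 2 := by
      have h0 : (0 : ℝ) ≤ ((D : ℝ) - 3) * ((D : ℝ) + 2) := mul_nonneg (by linarith) (by linarith)
      have e : ((D : ℝ) - 3) * ((D : ℝ) + 2) = (D : ℝ) ^ 2 - (D : ℝ) - 6 := by ring
      rw [e] at h0; linarith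
    calc Real.log ((D : ℝ) + 5) ≤ Real.log ((D : ℝ) ^ 2) := Real.log_le_log (by positivity) h1
      _ = 2 * 𝓛 := by rw [Real.log_pow, h𝓛def]; ring
  have hpk : ∀ s : ℂ, 1 - 2 * η ≤ s.re → |s.im| ≤ (D : ℝ) + 1 → s ≠ (ρ : ℂ) →
      χ.LFunction s ≠ 0 ∧ ‖(χ.LFunction s)⁻¹‖ ≤ 3 * Cinv * 𝓛 * (1 + ‖s - ρ‖⁻¹) := by
    intro s hs him hne
    have hls : Real.log (|s.im| + 4) ≤ 2 * 𝓛 :=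
      (Real.log_le_log (by positivity) (by linarith)).trans hlog5
    have hl0 : 0 ≤ Real.log (|s.im| + 4) := Real.log_nonneg (by linarith [abs_nonneg s.im])
    have hsum0 : 0 < Real.log D + Real.log (|s.im| + 4) := by rw [← h𝓛def]; linarith
    have hre : 1 - c / (Real.log D + Real.log (|s.im| + 4)) ≤ s.re := by
      have h1 : 2 * η ≤ c / (Real.log D + Real.log (|s.im| + 4)) := by
        rw [hηdef, le_div_iff₀ hsum0, ← h𝓛def]
        have : 2 * (c / (8 * 𝓛)) * (𝓛 + Real.log (|s.im| + 4)) ≤ 2 * (c / (8 * 𝓛)) * (3 * 𝓛) := by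
          gcongr; linarith
        have e : 2 * (c / (8 * 𝓛)) * (3 * 𝓛) = 3 * c / 4 := by field_simp; ring
        linarith
      linarith
    obtain ⟨hne0, hb⟩ := hzfp s hre hne
    refine ⟨hne0, hb.trans ?_⟩
    have : Cinv * (Real.log D + Real.log (|s.im| + 4)) ≤ 3 * Cinv * 𝓛 := by
      rw [← h𝓛def]
      calc Cinv * (𝓛 + Real.log (|s.im| + 4)) ≤ Cinv * (𝓛 + 2 * 𝓛) := by gcongr
        _ = 3 * Cinv * 𝓛 := by ring
    exact mul_le_mul_of_nonneg_right this (by positivity)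
  -- the continuation `U` of Lemma 8.3 (relative form)
  obtain ⟨U, hUd, hU1, hU2, hU3⟩ := h83 D χ hD83 hq hp h15 j hj d r hd hr hdr
  have hd0 : d ≠ 0 := by omega
  have hr0 : r ≠ 0 := by omega
  have hdr0 : d * r ≠ 0 := mul_ne_zero hd0 hr0
  -- `U` on `Re w ≥ 1 − η`: `‖U‖ ≤ C·𝔐 ≤ A₁𝓛^m`
  set MU : ℝ := C * Real.exp (2 * C * (Real.log (2 * Real.log D) + 4) +
    4 * C * Real.log D ^ 9 / (D : ℝ) ^ 2) with hMUdef
  have hMU0 : 0 ≤ MU := by positivity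
  have hlogdr : Real.log ((d * r : ℕ) : ℝ) ≤ Real.log D ^ 9 := by
    have hT2 : 1 ≤ bigT D ^ 2 := one_le_pow₀ (by rw [bigT]; exact Real.one_le_exp_iff.2 (by positivity))
    have h1 : ((d * r : ℕ) : ℝ) ≤ bigP D := by
      refine hdr.le.trans (div_le_self (bigP_pos D).le hT2)
    have h2 : (0 : ℝ) < ((d * r : ℕ) : ℝ) := by exact_mod_cast Nat.pos_of_ne_zero hdr0
    calc Real.log ((d * r : ℕ) : ℝ) ≤ Real.log (bigP D) := Real.log_le_log h2 h1
      _ = Real.log D ^ 9 := by rw [bigP, Real.log_exp, ell]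
  have hU : ∀ w : ℂ, 1 - η ≤ w.re → ‖U w‖ ≤ MU := by
    intro w hw
    have hw9 : 9 / 10 < w.re := by linarith
    have h1 := hU2 w hw9
    have hηL : 2 * η * Real.log D ≤ 1 / 4 := by
      have e : 2 * (c / (8 * 𝓛)) * 𝓛 = c / 4 := by field_simp; ring
      rw [hηdef, ← h𝓛def, e]
      linarith
    have hprod := prod_primeFactors_le (D := D) (n := d * r) (by rw [← h𝓛def]; linarith) hdr0 hlogdr
      hC0 hη0.le hηL (σ := w.re) hw
    calc ‖U w‖ ≤ C₈₃ * ∏ q ∈ (d * r).primeFactors, (1 + C₈₃ * (q : ℝ) ^ (-w.re)) := h1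
      _ ≤ |C₈₃ * ∏ q ∈ (d * r).primeFactors, (1 + C₈₃ * (q : ℝ) ^ (-w.re))| := le_abs_self _
      _ = C * ∏ q ∈ (d * r).primeFactors, |1 + C₈₃ * (q : ℝ) ^ (-w.re)| := by
          rw [abs_mul, Finset.abs_prod]
      _ ≤ C * ∏ q ∈ (d * r).primeFactors, (1 + C * (q : ℝ) ^ (-w.re)) := by
          refine mul_le_mul_of_nonneg_left ?_ hC0
          refine Finset.prod_le_prod (fun _ _ => abs_nonneg _) fun q _ => ?_
          calc |1 + C₈₃ * (q : ℝ) ^ (-w.re)| ≤ |(1 : ℝ)| + |C₈₃ * (q : ℝ) ^ (-w.re)| := abs_add_le _ _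
            _ = 1 + C * (q : ℝ) ^ (-w.re) := by
                rw [abs_one, abs_mul, abs_of_nonneg (Real.rpow_nonneg (Nat.cast_nonneg q) _)]
      _ ≤ MU := mul_le_mul_of_nonneg_left hprod hC0
  have hMUle : MU ≤ A₁ * 𝓛 ^ m := by
    have h := frakM_le (D := D) hC0 (by rw [← h𝓛def]; exact h𝓛1)
    rw [hMUdef, hA₁, h𝓛def]
    calc C * Real.exp (2 * C * (Real.log (2 * Real.log D) + 4) + 4 * C * Real.log D ^ 9 / (D : ℝ) ^ 2)
        ≤ C * (Real.exp (8 * C + 4 * C * ((Nat.factorial 9 : ℝ) / 2 ^ 9)) * 2 ^ ⌈2 * C⌉₊ *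
            Real.log D ^ ⌈2 * C⌉₊) := mul_le_mul_of_nonneg_left h hC0
      _ = _ := by rw [hm]; ring
  -- `U − Π` in the relative form with `C = |C₈₃|`
  have hU3' : ∀ s : ℂ, ‖s - 1‖ ≤ 5 * alpha D → ‖U s - PiW χ d r‖ ≤
      C * (ell D ^ 8)⁻¹ * ∏ q ∈ (d * r).primeFactors, (1 - (q : ℝ)⁻¹)⁻¹ := by
    intro s hs
    refine (hU3 s hs).trans ?_
    have := Literature.NumberTheory.Sieve.GreenTao2008.GYCorr.one_le_prod_one_sub_inv_inv (d * r)
    gcongr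
    exact le_abs_self _
  -- `L(s,χ)` on `Re s ≥ 1 − η`, `|s| ≤ D + 4`
  have hBL : ∀ s : ℂ, 1 - η ≤ s.re → ‖s‖ ≤ (D : ℝ) + 4 → ‖χ.LFunction s‖ ≤ 2 * (4 + 3 * 𝓛) := by
    intro s hs hsn
    have hls : Real.log (‖s‖ + 1) ≤ 2 * 𝓛 :=
      (Real.log_le_log (by positivity) (by linarith)).trans hlog5
    have hl0 : 0 ≤ Real.log (‖s‖ + 1) := Real.log_nonneg (by linarith [norm_nonneg s])
    have h := norm_LFunction_le_near_one χ hχ1 (η := η) (by linarith) hs (by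
      rw [← h𝓛def]
      calc η * (𝓛 + Real.log (‖s‖ + 1)) ≤ η * (𝓛 + 2 * 𝓛) := by gcongr
        _ = 3 * c / 8 := by rw [hηdef]; field_simp; ring
        _ ≤ 1 / 8 := by linarith)
    rw [← h𝓛def] at h
    linarith
  -- `|L′(1,χ)| ≥ ℓ₀`
  have hℓ : ℓ₀ ≤ ‖deriv χ.LFunction 1‖ := by
    have h := h57 D χ hp hq.sq_eq_one hL57 hc57L
    have hφpos : (0 : ℝ) < Nat.totient D := by exact_mod_cast Nat.totient_pos.mpr (by omega)
    have hφle : (Nat.totient D : ℝ) ≤ D := by exact_mod_cast Nat.totient_le D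
    have hrat : (1 : ℝ) ≤ (D : ℝ) / Nat.totient D := by rw [le_div_iff₀ hφpos]; linarith
    calc ℓ₀ = Real.exp (-1) / 4 * 1 := (mul_one _).symm
      _ ≤ Real.exp (-1) / 4 * ((D : ℝ) / Nat.totient D) := by gcongr
      _ ≤ (deriv χ.LFunction 1).re := h
      _ ≤ ‖deriv χ.LFunction 1‖ := Complex.re_le_norm _
  -- Lemma 5.8's range and the `E ≤ ℓ₀α/4` condition
  have hK₈L : K₈ * π ≤ Real.log D ^ 8 := hLK₈.trans (le_self_pow₀ h𝓛1 (by norm_num))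
  have hE : C₅ / Real.log D ^ 15 ≤ ℓ₀ * alpha D / 4 := by
    rw [← hαdef, hαeq, ← h𝓛def]
    rw [div_le_iff₀ (by positivity)]
    have h1 : 4 * C₅ ≤ ℓ₀ * π * 𝓛 := by rw [div_le_iff₀ (by positivity)] at hLC₅; linarith
    have h2 : 𝓛 ^ 15 = 𝓛 ^ 9 * 𝓛 ^ 6 := by ring
    have h3 : 𝓛 ≤ 𝓛 ^ 6 := le_self_pow₀ h𝓛1 (by norm_num)
    have h4 : ℓ₀ * π * 𝓛 ≤ ℓ₀ * π * 𝓛 ^ 6 := mul_le_mul_of_nonneg_left h3 (by positivity)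
    calc C₅ = 4 * C₅ / 4 := by ring
      _ ≤ ℓ₀ * π * 𝓛 ^ 6 / 4 := by linarith
      _ = ℓ₀ * (π / 𝓛 ^ 9) / 4 * 𝓛 ^ 15 := by rw [h2]; field_simp
  -- the core estimate
  have hcore := Repair.Gap.lemma84_core_of_norm_le_pow15 χ c' hχ1 hp h𝓛3 h15 j μ hd0 hr0 hy1 U (ρ := ρ) (η := η) (MU := MU)
    (BL := 2 * (4 + 3 * 𝓛)) (Minv := 3 * Cinv * 𝓛) (C₈₃ := C) (K := K₈) (ℓ₀ := ℓ₀) hUd hU1 hMU0 hU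
    hC0 hU3' hαη hη40 (by positivity) hBL (by positivity) hpk hρ1 hρη hρα hLρ hL'ρ hℓ₀0 hℓ le_rfl
    hK₈L hE
  refine hcore.trans ?_
  -- sizes of `log y`
  have hy0 : 0 < y := lt_trans (by rw [bigT]; exact Real.exp_pos _) hy1
  have hLy1 : 𝓛 ^ (1.1 : ℝ) ≤ Real.log y := by
    have : Real.log (bigT D) ≤ Real.log y := Real.log_le_log (by rw [bigT]; exact Real.exp_pos _) hy1.le
    rwa [bigT, Real.log_exp] at this
  have hLy2 : Real.log y ≤ 𝓛 ^ 9 := by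
    have : Real.log y ≤ Real.log (bigP D) := Real.log_le_log hy0 hy2.le
    rwa [bigP, Real.log_exp] at this
  have h := rhs_le (Ly := Real.log y) (hatPi := ∏ q ∈ (d * r).primeFactors, (1 - (q : ℝ)⁻¹)⁻¹)
    (α := alpha D) (η := η) (T := (D : ℝ)) (BL := 2 * (4 + 3 * 𝓛)) (Minv := 3 * Cinv * 𝓛)
    h𝓛3 hc hc4 hCinv hC0 hK₈1 hA₁0 hMU0 hMUle
    (Literature.NumberTheory.Sieve.GreenTao2008.GYCorr.one_le_prod_one_sub_inv_inv (d * r)) hLy1 hLy2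
    hαeq rfl hDexp rfl rfl
  rw [hCfin]
  exact h

/-- **Lemma 8.4 (relative) under `Repair.Bed.AssumptionAWith E`, every real `E ≥ 15`, from Lemma 8.3 (relative) under the
`𝓛⁻¹⁵` guard** (transfer lemma; at `E = 2022` the conclusion is the body of the tree leaf `Skeleton.Lemma84Rel c′`).
[cite: Zhang2022LandauSiegel, §8 Lemma 8.4] -/
theorem lemma84Rel_of_assumptionAWith_of_lemma83Rel_pow15 {c' : ℝ}
    (h83 : (∃ C : ℝ, ForAllLarge fun D _ χ => ‖χ.LFunction 1‖ ≤ 1 / Real.log D ^ 15 →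
      ∀ j ∈ ({1, 2, 3} : Finset ℕ), ∀ d r : ℕ, 1 ≤ d → 1 ≤ r → ((d * r : ℕ) : ℝ) < bigP D / bigT D ^ 2 →
        ∃ U : ℂ → ℂ, DifferentiableOn ℂ U {s : ℂ | 9 / 10 < s.re} ∧
          (∀ s : ℂ, 1 < s.re → U s = χ.LFunction s /
              (χ.LFunction (s + betaJ c' D (j + 1)) * χ.LFunction (s + betaJ c' D (j + 2))) *
                xiSeries c' χ j d r s) ∧
          (∀ s : ℂ, 9 / 10 < s.re →
            ‖U s‖ ≤ C * ∏ q ∈ (d * r).primeFactors, (1 + C * (q : ℝ) ^ (-s.re))) ∧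
          (∀ s : ℂ, ‖s - 1‖ ≤ 5 * alpha D →
            ‖U s - PiW χ d r‖ ≤ C * (ell D ^ 8)⁻¹ * ∏ q ∈ (d * r).primeFactors, (1 - (q : ℝ)⁻¹)⁻¹))) {E : ℝ} (hE : 15 ≤ E) :
    ∃ C : ℝ, ForAllLarge fun D _ χ => AssumptionAWith E D χ →
      ∀ j ∈ ({1, 2, 3} : Finset ℕ), ∀ μ ∈ ({6, 7} : Finset ℕ), ∀ d r : ℕ, 1 ≤ d → 1 ≤ r →
        ((d * r : ℕ) : ℝ) < bigP D / bigT D ^ 2 → ∀ y : ℝ, bigT D < y → y < bigP D →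
          ‖(∑ n ∈ Finset.Ico 1 ⌈y⌉₊, χ (n : ZMod D) * xiZero c' D j n d r / (n : ℂ) *
                ((y / n : ℝ) : ℂ) ^ (-betaMu D μ) * (Real.log (y / n) : ℂ)) -
              deriv χ.LFunction 1 * PiW χ d r * frakgW c' D j μ y‖ ≤
            C * (ell D ^ 6)⁻¹ * (∏ q ∈ (d * r).primeFactors, (1 - (q : ℝ)⁻¹)⁻¹) ^ 2 := by
  obtain ⟨C, h⟩ := lemma84Rel_pow15_of_lemma83Rel_pow15 h83
  exact ⟨C, Repair.Gap.forAllLarge_assumptionAWith_of_pow15 hE h⟩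

end Literature.NumberTheory.LFunctions.Zhang2022.Lemma84
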